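/-
Copyright: the b2b-balaban cell (near-miss cell 7), T⁴-continuum fan-out; row NE7b crux team, seat
t4-ne7b-formalise-leaf-05 gen 25 (IR-41-5 «S12-W», leaf-05 part: the J-layer zone-skeleton twins, file J1 «CONTACT-Z»;
S12-W work list §A row J of leaf-03 gen 21).  Released under the licence of the surrounding project.
-/
import Summits.QuantumFields.BalabanUV.T4Continuum.Support.HistoryJoinsPlacedContact
import Summits.QuantumFields.BalabanUV.T4Continuum.Support.HistoryZonesOrbitRealiseZ

/-!
# T3b, file 3a «CONTACT» over the ZONE SKELETON of a realisation (J1, the `RealisesZ` twin of file 3a's §2)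

Summits-side support leaf of the T⁴-continuum cell (rung (B)+1 on a FINITE torus only; NOT infinite volume, NOT the
mass gap, NOT the Clay statement; NOT a proof of the spine estimate NE7b, which is the cell's OWN estimate, NOT PRINTED
and NOT PROVED).  Row NE7b, owner road R-P1, repair route R-41-a (owner g41): the END ∕ headline re-plug over the
memory-agnostic carriers (INTERFACE REQUEST NE7b IR-41-5 «S12-W», «leaf-02∕05 on their own modules»; S12-W work list
§A row J).  [folklore] finite tree bookkeeping over the lineage's OWN carriers; nothing is quoted from print, nothing
printed is asserted, no `[cite:]` tag, no `Prop`-valued fact minted, no definition.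

WHY.  File 3a (`HistoryJoinsPlacedContact`, this lineage gen 4) proves that a member REALISED along a run — in row S1b's
letters `HistoryRealise.Realises L s R g Z` — satisfies the listing-free cluster predicate.  Its proofs read of the
renewal clause only «an earlier last step» and of the join clause only the partners' dating and CONTACT: exactly
leaf-07 gen 17's clock-free ZONE SKELETON `HistoryZones.RealisesZ L s g Z` (`HistoryZonesOrbitRealiseZ`, IR-41-6), the
common weakening of `Realises`, of the owner's print-exact `RealisesP` and of the owner's `RealisesW` (R-41-a core).  This
file re-runs file 3a's §2 over `RealisesZ` — statements = the landed ones with `Realises L sP R g Z ↦ RealisesZ L sP g Z`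
(the sizes `R` disappear), proofs = the landed scripts with `births_facts_of_corr ↦ births_facts_of_corrZ`,
`contact_of_corr ↦ contact_of_corrZ`, `lastStep_realises_le ↦ lastStep_realisesZ_le` and the idle pendency ∕ readiness
pattern slots removed — so that the J layer is typed ONCE for the frozen, P and W carriers (bridges
`realisesZ_of_realises`, `realisesZ_of_realisesP`, and leaf-03∕leaf-07's `realisesZ_of_realisesW`), final against any
further readiness ∕ memory correction (R-41-a's design rule).  File 3a's §1 (zones of members) reads no realisation and
is used as landed.

WHAT.  §1 `nonempty_zone_of_realisesZ`, `realisesZ_subAt_of_mem_clusterParts`, `tconn_clusterParts_of_realisesZ`,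
`clusterConn_aux_of_realisesZ`, **`clusterConn_of_realisesZ`**, `clusterConn_of_realisesZ'` (leaf-10 gen 6's letters
`PGen.ClusterConn`).  §2 sanity: the LANDED statement `clusterConn_of_realises'` and its print-exact twin are the
corollaries through the two bridges.

HONEST SCOPE.  Bookkeeping over OUR carriers; `RealisesZ` (a weakening of H3's reading) is a HYPOTHESIS here, not
discharged; nothing of H3∕(B)∕BetaPertH touched; `hdis`∕`hmult` NOT retired; by-name class of every `WALL-NE7b-P1.md` §2
binder UNCHANGED; NE7b NOT proved.  HONEST DEPENDENCY (cell): continuum YM on T⁴ ⇐ BetaPertH ∧ nine spine estimates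
(0/9 proved); BetaPertH ⇐ (D1) ∧ (D4) ∧ CAP+tail; G-an2-4 gates asym, D1 and NE2/3/4.  This file changes none of it.
-/

open Finset
open Literature.MathematicalPhysics.QuantumFieldTheory.Balaban1983to89
open Literature.MathematicalPhysics.QuantumFieldTheory.Balaban1983to89.B13ScaleTransfer (Pt FaceConnected)
open Literature.MathematicalPhysics.QuantumFieldTheory.Balaban1983to89.B16SProfile (DropCtl)
open T4PersistenceDictionary T4PartnerMultiplicity T4BranchingRecordsGas
open Summit.QuantumFields.BalabanUV.T4Continuum.PlacementSkeleton
open Summit.QuantumFields.BalabanUV.T4Continuum.ZoneTorus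
open Summit.QuantumFields.BalabanUV.T4Continuum.HistoryZones
open Summit.QuantumFields.BalabanUV.T4Continuum.HistoryZoneEvolve
open Summit.QuantumFields.BalabanUV.T4Continuum.HistoryZoneMassPieces
open Summit.QuantumFields.BalabanUV.T4Continuum.HistoryAdmissible
open Summit.QuantumFields.BalabanUV.T4Continuum.HistoryRealise
open Summit.QuantumFields.BalabanUV.T4Continuum.HistoryJoins
open Summit.QuantumFields.BalabanUV.T4Continuum.HistoryJoinsAdm
open Summit.QuantumFields.BalabanUV.T4Continuum.HistoryZoneMassJoins
open Summit.QuantumFields.BalabanUV.T4Continuum.HistoryJoinsClusterContact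
open Summit.QuantumFields.BalabanUV.T4Continuum.HistoryJoinsPlacedValue

namespace Summit.QuantumFields.BalabanUV.T4Continuum.HistoryJoinsPlacedContact

noncomputable section

open scoped Classical

/-! ## §1 A zone-skeleton realised member satisfies the listing-free cluster predicate -/

section RealisedZ

variable {d n L : ℕ} (hL : 3 ≤ L) (hn : 0 < n) {sP : ℕ → ℕ} (hs : ∀ t, sP (t + 1) ≤ sP t)
  (hdrop : ∀ m, DropCtl sP m) {K : ℕ}
include hL hn hs hdrop

/-- **A ZONE-SKELETON REALISED MEMBER HAS A NON-EMPTY ZONE FROM ITS LAST STEP ON** (its root birth: anchor ∈ region,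
dated at the root step `≤ lastStep`). [folklore] -/
theorem nonempty_zone_of_realisesZ {m : PGen (Pt d × Finset (Pt d))} {Z : Finset (Pt d)} (hR : RealisesZ L sP m Z)
    {t : ℕ} (ht : m.lastStep ≤ t) :
    (regZoneD Prod.fst n L K (levelOf sP K) 32 (regR Prod.fst Prod.snd n L K (levelOf sP K)) t (toGenL m)).Nonempty := by
  obtain ⟨bz, hbz, hstep⟩ := exists_root_pbirth m
  have hb : bz ∈ births (toGenL m) := by rw [births_toGenL]; exact Multiset.mem_toFinset.2 hbz
  have hfacts := births_facts_of_corrZ m (toGenL m) Z (corr_toGenL m) hR bz hb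
  refine nonempty_regZoneD_toGenL n L K _ 32 hn (by omega) (levelFn_levelOf (fun t _ => hs t) (hdrop K))
    ⟨bz, hbz, ?_, ⟨_, hfacts.2.1⟩⟩
  rw [hstep]
  exact (lastStep_realisesZ_le m Z hR).trans ht

omit hL hn hs hdrop in
/-- **THE CLUSTER PARTS OF A ZONE-SKELETON REALISED MEMBER ARE ZONE-SKELETON REALISED SUB-MEMBERS, NO YOUNGER THAN THE
MEMBER.** [folklore] -/
theorem realisesZ_subAt_of_mem_clusterParts (s' : ℕ) :
    ∀ (m : PGen (Pt d × Finset (Pt d))) (Z : Finset (Pt d)), RealisesZ L sP m Z →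
      ∀ p ∈ clusterParts PEv.step s' m.toGen,
        ∃ Z', RealisesZ L sP (PGen.subAt m p.1) Z' ∧ (PGen.subAt m p.1).lastStep ≤ m.lastStep
  | PGen.birth j cls x, Z, hR, p, hp => by
      simp only [PGen.toGen, clusterParts_born, List.mem_singleton] at hp
      subst hp; exact ⟨Z, hR, le_rfl⟩
  | PGen.renew G h, Z, hR, p, hp => by
      simp only [PGen.toGen, clusterParts_renew, List.mem_singleton] at hp
      subst hp; exact ⟨Z, hR, le_rfl⟩
  | PGen.join A B s₀, Z, hR, p, hp => by
      by_cases hst : PEv.step ((s₀, 2, 0) : PEv) = s'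
      · obtain ⟨ZA, ZB, hA, hB, hAt, hBt, -, -⟩ := hR
        rw [PGen.toGen, clusterParts_merge_of_eq PEv.step hst, List.mem_append, List.mem_map, List.mem_map] at hp
        rcases hp with ⟨q, hq, rfl⟩ | ⟨q, hq, rfl⟩
        · obtain ⟨Z', hZ', hle⟩ := realisesZ_subAt_of_mem_clusterParts s' A ZA hA q hq
          exact ⟨Z', by rw [PGen.subAt_join_false]; exact hZ', by rw [PGen.subAt_join_false]; exact hle.trans hAt⟩
        · obtain ⟨Z', hZ', hle⟩ := realisesZ_subAt_of_mem_clusterParts s' B ZB hB q hq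
          exact ⟨Z', by rw [PGen.subAt_join_true]; exact hZ', by rw [PGen.subAt_join_true]; exact hle.trans hBt⟩
      · rw [PGen.toGen, clusterParts_merge_of_ne PEv.step hst, List.mem_singleton] at hp
        subst hp; exact ⟨Z, hR, le_rfl⟩

/-- **THE TOP CLUSTER OF A ZONE-SKELETON REALISED MEMBER IS TOUCH-CONNECTED**, at any cut `s′`: at a same-step join the
partners' part lists are touch-connected by induction and BRIDGED by leaf-07 gen 17's zone-skeleton contact of the
partners' whole zones (`contact_of_corrZ`), each the union of its parts' zones. [folklore] -/
theorem tconn_clusterParts_of_realisesZ :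
    ∀ (m : PGen (Pt d × Finset (Pt d))) (Z : Finset (Pt d)), RealisesZ L sP m Z → m.lastStep ≤ K → ∀ s' : ℕ,
      TConn (fun A B => (A ∩ B).Nonempty)
        ((clusterParts PEv.step s' m.toGen).map fun p =>
          regZoneD Prod.fst n L K (levelOf sP K) 32 (regR Prod.fst Prod.snd n L K (levelOf sP K)) s'
            (toGenL (PGen.subAt m p.1)))
  | PGen.birth j cls x, Z, _, _, s' => by
      simp only [PGen.toGen, clusterParts_born, List.map_singleton]
      exact tconn_singleton _ _
  | PGen.renew G h, Z, _, _, s' => by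
      simp only [PGen.toGen, clusterParts_renew, List.map_singleton]
      exact tconn_singleton _ _
  | PGen.join A B s₀, Z, hR, hK, s' => by
      by_cases hst : PEv.step ((s₀, 2, 0) : PEv) = s'
      · have hs₀ : s₀ = s' := hst
        have hK' : s₀ ≤ K := hK
        have hR' := hR
        obtain ⟨ZA, ZB, hA, hB, hAt, hBt, -, -⟩ := hR'
        rw [PGen.toGen, clusterParts_merge_of_eq PEv.step hst, List.map_append, List.map_map, List.map_map]
        have eA : ((fun p : List Bool × Gen PEv =>
              regZoneD Prod.fst n L K (levelOf sP K) 32 (regR Prod.fst Prod.snd n L K (levelOf sP K)) s'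
                (toGenL (PGen.subAt (PGen.join A B s₀) p.1))) ∘ fun q : List Bool × Gen PEv => (false :: q.1, q.2)) =
            fun p => regZoneD Prod.fst n L K (levelOf sP K) 32 (regR Prod.fst Prod.snd n L K (levelOf sP K)) s'
              (toGenL (PGen.subAt A p.1)) := by
          funext p; simp only [Function.comp_apply, PGen.subAt_join_false]
        have eB : ((fun p : List Bool × Gen PEv =>
              regZoneD Prod.fst n L K (levelOf sP K) 32 (regR Prod.fst Prod.snd n L K (levelOf sP K)) s'
                (toGenL (PGen.subAt (PGen.join A B s₀) p.1))) ∘ fun q : List Bool × Gen PEv => (true :: q.1, q.2)) =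
            fun p => regZoneD Prod.fst n L K (levelOf sP K) 32 (regR Prod.fst Prod.snd n L K (levelOf sP K)) s'
              (toGenL (PGen.subAt B p.1)) := by
          funext p; simp only [Function.comp_apply, PGen.subAt_join_true]
        rw [eA, eB]
        have hTA := tconn_clusterParts_of_realisesZ A ZA hA (hAt.trans hK') s'
        have hTB := tconn_clusterParts_of_realisesZ B ZB hB (hBt.trans hK') s'
        -- the bridge: the partners' whole zones share a cell at the join step
        obtain ⟨z, hzA, hzB⟩ := contact_of_corrZ hL hn hs hdrop (PGen.join A B s₀) (toGenL (PGen.join A B s₀)) Z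
          (corr_toGenL _) hR hK (toGenL A) (toGenL B) ((((s₀, 2, 0) : PEv)), default) (Sub.refl _)
        have hzA' : z ∈ regZoneD Prod.fst n L K (levelOf sP K) 32 (regR Prod.fst Prod.snd n L K (levelOf sP K)) s'
            (toGenL A) := by rw [← hs₀]; exact hzA
        have hzB' : z ∈ regZoneD Prod.fst n L K (levelOf sP K) 32 (regR Prod.fst Prod.snd n L K (levelOf sP K)) s'
            (toGenL B) := by rw [← hs₀]; exact hzB
        rw [← lunion_clusterParts_subAt n L K (levelOf sP K) 32 s' s' A, mem_lunion] at hzA'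
        rw [← lunion_clusterParts_subAt n L K (levelOf sP K) 32 s' s' B, mem_lunion] at hzB'
        obtain ⟨SA, hSA, hzSA⟩ := hzA'
        obtain ⟨SB, hSB, hzSB⟩ := hzB'
        exact tconn_append_of_bridge (fun _ _ h => by rwa [inter_comm]) hTA hTB hSA hSB ⟨z, mem_inter.2 ⟨hzSA, hzSB⟩⟩
      · rw [PGen.toGen, clusterParts_merge_of_ne PEv.step hst, List.map_singleton]
        exact tconn_singleton _ _

/-- **EVERY JOIN ROOT OF A ZONE-SKELETON REALISED MEMBER HAS NON-EMPTY, TOUCH-CONNECTED PART ZONES** (all join roots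
below any parent step `o`). [folklore] -/
theorem clusterConn_aux_of_realisesZ :
    ∀ (g : PGen (Pt d × Finset (Pt d))) (Z : Finset (Pt d)), RealisesZ L sP g Z → g.lastStep ≤ K →
      ∀ (o : Option ℕ), ∀ q ∈ crootsP PEv.step o g.toGen,
        (∀ p ∈ jparts PEv.step q.2,
            (regZoneD Prod.fst n L K (levelOf sP K) 32 (regR Prod.fst Prod.snd n L K (levelOf sP K))
              (ftime PEv.step q.2) (toGenL (PGen.subAt g (q.1 ++ p.1)))).Nonempty) ∧
          TConn (fun A B => (A ∩ B).Nonempty)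
            ((jparts PEv.step q.2).map fun p =>
              regZoneD Prod.fst n L K (levelOf sP K) 32 (regR Prod.fst Prod.snd n L K (levelOf sP K))
                (ftime PEv.step q.2) (toGenL (PGen.subAt g (q.1 ++ p.1))))
  | PGen.birth j cls x, Z, _, _, o, q, hq => by simp [PGen.toGen, crootsP] at hq
  | PGen.renew G h, Z, hR, hK, o, q, hq => by
      obtain ⟨ZG, hG, hlt, -⟩ := hR
      have hGK : G.lastStep ≤ K := by simp only [PGen.lastStep] at hK; omega
      have hq' : q ∈ crootsP PEv.step none G.toGen := by simpa [PGen.toGen, crootsP] using hq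
      obtain ⟨X, Y, e, hXY⟩ := exists_eq_merge_of_mem_crootsP PEv.step none G.toGen q hq'
      have hsub : ∀ p ∈ jparts PEv.step q.2, PGen.subAt (PGen.renew G h) (q.1 ++ p.1) = PGen.subAt G (q.1 ++ p.1) :=
        fun p hp => PGen.subAt_renew_of_ne_nil G h (by
          rw [hXY] at hp
          have := PGen.fst_ne_nil_of_mem_jparts PEv.step hp
          exact fun h0 => this (List.append_eq_nil_iff.1 h0).2)
      obtain ⟨ih1, ih2⟩ := clusterConn_aux_of_realisesZ G ZG hG hGK none q hq'
      refine ⟨fun p hp => by rw [hsub p hp]; exact ih1 p hp, ?_⟩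
      rw [List.map_congr_left fun p hp => by rw [hsub p hp]]
      exact ih2
  | PGen.join A B s₀, Z, hR, hK, o, q, hq => by
      have hR' := hR
      obtain ⟨ZA, ZB, hA, hB, hAt, hBt, -, -⟩ := hR'
      have hK' : s₀ ≤ K := hK
      simp only [PGen.toGen, crootsP, List.mem_append, List.mem_map] at hq
      rcases hq with hq | ⟨q', hq', rfl⟩ | ⟨q', hq', rfl⟩
      · -- the top join root
        split_ifs at hq with ho
        · simp at hq
        · rw [List.mem_singleton] at hq
          subst hq
          simp only [List.nil_append]
          refine ⟨fun p hp => ?_, ?_⟩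
          · obtain ⟨Z', hZ', hle⟩ := realisesZ_subAt_of_mem_clusterParts _ (PGen.join A B s₀) Z hR p
              (by simpa [jparts, PGen.toGen] using hp)
            have hne := nonempty_zone_of_realisesZ hL hn hs hdrop (K := K) hZ' hle
            simpa [ftime, PGen.toGen, PGen.lastStep] using hne
          · have h := tconn_clusterParts_of_realisesZ hL hn hs hdrop (PGen.join A B s₀) Z hR hK s₀
            simpa [jparts, PGen.toGen, ftime] using h
      · -- a join root below the first partner
        obtain ⟨ih1, ih2⟩ := clusterConn_aux_of_realisesZ A ZA hA (hAt.trans hK') (some (PEv.step ((s₀, 2, 0) : PEv)))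
          q' hq'
        refine ⟨fun p hp => ?_, ?_⟩
        · have := ih1 p hp
          simpa only [List.cons_append, PGen.subAt_join_false] using this
        · simpa only [List.cons_append, PGen.subAt_join_false] using ih2
      · -- a join root below the second partner
        obtain ⟨ih1, ih2⟩ := clusterConn_aux_of_realisesZ B ZB hB (hBt.trans hK') (some (PEv.step ((s₀, 2, 0) : PEv)))
          q' hq'
        refine ⟨fun p hp => ?_, ?_⟩
        · have := ih1 p hp
          simpa only [List.cons_append, PGen.subAt_join_true] using this
        · simpa only [List.cons_append, PGen.subAt_join_true] using ih2

/-- **A ZONE-SKELETON REALISED MEMBER SATISFIES THE LISTING-FREE CLUSTER PREDICATE** for the levelled `32`-zones of the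
run: at every join root `q` of its flat tree the zones at the join step of the part sub-members `subAt g (q.1 ++ p.1)`
are non-empty and touch-connected. [folklore] -/
theorem clusterConn_of_realisesZ {g : PGen (Pt d × Finset (Pt d))} {Z : Finset (Pt d)} (hR : RealisesZ L sP g Z)
    (hK : g.lastStep ≤ K) :
    ∀ q ∈ croots PEv.step g.toGen,
      (∀ p ∈ jparts PEv.step q.2,
          (regZoneD Prod.fst n L K (levelOf sP K) 32 (regR Prod.fst Prod.snd n L K (levelOf sP K))
            (ftime PEv.step q.2) (toGenL (PGen.subAt g (q.1 ++ p.1)))).Nonempty) ∧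
        TConn (fun A B => (A ∩ B).Nonempty)
          ((jparts PEv.step q.2).map fun p =>
            regZoneD Prod.fst n L K (levelOf sP K) 32 (regR Prod.fst Prod.snd n L K (levelOf sP K))
              (ftime PEv.step q.2) (toGenL (PGen.subAt g (q.1 ++ p.1)))) :=
  fun q hq => clusterConn_aux_of_realisesZ hL hn hs hdrop g Z hR hK none q hq

/-- … in leaf-10 gen 6's letters `PGen.ClusterConn` (`HistoryMemberClusterConn`, the touch-connectedness conjunct).
[folklore] -/
theorem clusterConn_of_realisesZ' {g : PGen (Pt d × Finset (Pt d))} {Z : Finset (Pt d)} (hR : RealisesZ L sP g Z)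
    (hK : g.lastStep ≤ K) :
    PGen.ClusterConn (fun t m =>
      regZoneD Prod.fst n L K (levelOf sP K) 32 (regR Prod.fst Prod.snd n L K (levelOf sP K)) t (toGenL m)) g :=
  fun q hq => (clusterConn_aux_of_realisesZ hL hn hs hdrop g Z hR hK none q hq).2

end RealisedZ

/-! ## §2 Sanity: the landed statement and its print-exact twin through the bridges -/

section SanityJ1

variable {d n L : ℕ} (hL : 3 ≤ L) (hn : 0 < n) {sP : ℕ → ℕ} (hs : ∀ t, sP (t + 1) ≤ sP t)
  (hdrop : ∀ m, DropCtl sP m) {R : ℕ → ℕ} {K : ℕ}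

/-- the LANDED `clusterConn_of_realises'` (row S1b's frozen reading) is the corollary through bridge 1 [folklore] -/
example {g : PGen (Pt d × Finset (Pt d))} {Z : Finset (Pt d)} (hR : Realises L sP R g Z) (hK : g.lastStep ≤ K) :
    PGen.ClusterConn (fun t m =>
      regZoneD Prod.fst n L K (levelOf sP K) 32 (regR Prod.fst Prod.snd n L K (levelOf sP K)) t (toGenL m)) g :=
  clusterConn_of_realisesZ' hL hn hs hdrop (realisesZ_of_realises g Z hR) hK

/-- the owner's PRINT-EXACT reading `RealisesP` (R-40-a) gives the same, through bridge 2 [folklore] -/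
example {g : PGen (Pt d × Finset (Pt d))} {Z : Finset (Pt d)} (hR : HistoryRealisePrint.RealisesP L sP R g Z)
    (hK : g.lastStep ≤ K) :
    PGen.ClusterConn (fun t m =>
      regZoneD Prod.fst n L K (levelOf sP K) 32 (regR Prod.fst Prod.snd n L K (levelOf sP K)) t (toGenL m)) g :=
  clusterConn_of_realisesZ' hL hn hs hdrop (realisesZ_of_realisesP g Z hR) hK

end SanityJ1

end

end Summit.QuantumFields.BalabanUV.T4Continuum.HistoryJoinsPlacedContact
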